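import Literature.NumberTheory.Sieve.Maynard2016DenseClustersRFoldSums
import HarnessLib

/-!
# [Maynard2016DenseClusters, proof of Prop. 9.1 p. 20] — a one-profile majorant of `F₂`

To evaluate the `E_diff` sum `∑_{r ∈ 𝒟_k} F₂(u(r))² w(∏r)` (printed: «Lemma 8.4 shows the right hand side
is `≪ k T_k (log R)^{−1}` times the main term») with the tree's `r`-fold sum of Lemma 8.4
(`MaynardDense.rFoldSum`, ONE profile `G` in every coordinate), we dominate
`F₂(t) = ∑ⱼ h_k(tⱼ) ∏_{i≠j} g_k(tᵢ)` by a single product: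
`F₂(t) ≤ k ∏ᵢ (g_k(tᵢ) + h_k(tᵢ)/k)` (`t ≥ 0`; expand the product and keep the `k` terms with exactly
one `h_k/k`). Since `h_k` is supported on `[0, 2]`, the profile is used at scale `R²`:
`mixG k s = profExt k (2s) + prof₂Ext k (2s)/k` (a `C¹(ℝ)` representative vanishing on `[1, ∞)`), and we
record the hypotheses `(G)` of `lemma84_all'_dec` for `G = mixG²` together with
`γ_k/2 ≤ ∫₀^∞ mixG² ≤ (γ_k + 3γ_{h,k}/k)/2`.

## References
* J. Maynard, *Dense clusters of primes in subsets*, Compositio Math. 152 (2016); arXiv:1405.2593,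
  (7.4)–(7.6), Lemma 8.4, Lemma 8.6, proof of Prop. 9.1 p. 20. [Maynard2016DenseClusters]
-/

noncomputable section

open MeasureTheory Set Finset Filter Real
open scoped Topology

namespace Literature.NumberTheory.Sieve.MaynardDense

variable {k : ℕ}

/-! ## §1 A smooth representative of `h_k` -/

/-- Derivative of `h_k(t) = ψ(t/2)/(1 + T_k t)` away from the pole. [cite: Maynard2016DenseClusters, (7.6)] -/
theorem hasDerivAt_prof₂ (hk : 2 ≤ k) {t : ℝ} (ht : -1 < T k * t) :
    HasDerivAt (prof₂ k)
      ((deriv psi (t / 2) / 2 * (1 + T k * t) - psi (t / 2) * T k) / (1 + T k * t) ^ 2) t := by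
  have hden : 1 + T k * t ≠ 0 := by linarith
  have h1 : HasDerivAt (fun t => psi (t / 2)) (deriv psi (t / 2) / 2) t := by
    have ha : HasDerivAt (fun t : ℝ => t / 2) (1 / 2) t := by
      simpa using (hasDerivAt_id t).div_const (2 : ℝ)
    have hb : HasDerivAt psi (deriv psi (t / 2)) (t / 2) := (differentiable_psi _).hasDerivAt
    have hc := hb.comp t ha
    have e : deriv psi (t / 2) * (1 / 2) = deriv psi (t / 2) / 2 := by ring
    rw [e] at hc
    exact hc
  have h2 : HasDerivAt (fun t => 1 + T k * t) (T k) t := by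
    simpa using ((hasDerivAt_id t).const_mul (T k)).const_add 1
  have h' : HasDerivAt (fun t => psi (t / 2) / (1 + T k * t))
      ((deriv psi (t / 2) / 2 * (1 + T k * t) - psi (t / 2) * T k) / (1 + T k * t) ^ 2) t :=
    h1.div h2 hden
  have hk' := hk
  unfold prof₂
  exact h'

/-- `|h_k'(t)| ≤ 15 + T_k` for `t ≥ 0`. [cite: Maynard2016DenseClusters, proof of Lemma 8.5 («Ω_G = O(kT_k)»), (7.6)] -/
theorem abs_deriv_prof₂_le (hk : 2 ≤ k) {t : ℝ} (ht : 0 ≤ t) :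
    |deriv (prof₂ k) t| ≤ 15 + T k := by
  have hT := T_pos hk
  have hTt : 0 ≤ T k * t := by positivity
  rw [(hasDerivAt_prof₂ hk (by linarith)).deriv, abs_div,
    abs_of_pos (by positivity : (0:ℝ) < (1 + T k * t) ^ 2), div_le_iff₀ (by positivity)]
  have hA : |deriv psi (t / 2)| ≤ 30 := abs_deriv_psi_le _
  have hψ0 := psi_nonneg (t / 2)
  have hψ1 := psi_le_one (t / 2)
  have hX : 1 + T k * t ≤ (1 + T k * t) ^ 2 := by nlinarith
  have hX1 : (1 : ℝ) ≤ (1 + T k * t) ^ 2 := by nlinarith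
  calc |deriv psi (t / 2) / 2 * (1 + T k * t) - psi (t / 2) * T k|
      ≤ |deriv psi (t / 2) / 2 * (1 + T k * t)| + |psi (t / 2) * T k| := abs_sub _ _
    _ = |deriv psi (t / 2)| / 2 * (1 + T k * t) + psi (t / 2) * T k := by
        rw [abs_mul, abs_div, abs_two, abs_of_pos (by linarith : (0:ℝ) < 1 + T k * t), abs_mul,
          abs_of_nonneg hψ0, abs_of_pos hT]
    _ ≤ 15 * (1 + T k * t) + 1 * T k := by
        gcongr
        linarith
    _ ≤ (15 + T k) * (1 + T k * t) ^ 2 := by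
        nlinarith [mul_le_mul_of_nonneg_left hX (by norm_num : (0:ℝ) ≤ 15),
          mul_le_mul_of_nonneg_left hX1 hT.le]

/-- `prof₂Ext k t = smoothTransition(2 + 4T_k t) · h_k(t)`: a `C^∞(ℝ)` function equal to `h_k` on `[0, ∞)`
and to `0` on `(−∞, −1/(2T_k)]`. [cite: Maynard2016DenseClusters, Lemma 8.4 («G : ℝ → ℝ … smooth»), (7.6)] -/
def prof₂Ext (k : ℕ) (t : ℝ) : ℝ := Real.smoothTransition (2 + 4 * T k * t) * prof₂ k t

/-- `prof₂Ext k = h_k` on `(−1/(4T_k), ∞)`. [cite: Maynard2016DenseClusters, Lemma 8.4, (7.6)] -/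
theorem prof₂Ext_of_gt {t : ℝ} (ht : -1 < 4 * T k * t) : prof₂Ext k t = prof₂ k t := by
  unfold prof₂Ext
  rw [Real.smoothTransition.one_of_one_le (by linarith), one_mul]

/-- `prof₂Ext k = h_k` on `[0, ∞)`. [cite: Maynard2016DenseClusters, Lemma 8.4, (7.6)] -/
theorem prof₂Ext_of_nonneg (hk : 2 ≤ k) {t : ℝ} (ht : 0 ≤ t) : prof₂Ext k t = prof₂ k t :=
  prof₂Ext_of_gt (by have := T_pos hk; nlinarith)

/-- `prof₂Ext k = 0` on `(−∞, −1/(2T_k)]`. [cite: Maynard2016DenseClusters, Lemma 8.4] -/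
theorem prof₂Ext_of_le {t : ℝ} (ht : 2 + 4 * T k * t ≤ 0) : prof₂Ext k t = 0 := by
  unfold prof₂Ext
  rw [Real.smoothTransition.zero_of_nonpos ht, zero_mul]

/-- **`prof₂Ext k` is smooth on `ℝ`.** [cite: Maynard2016DenseClusters, Lemma 8.4 («G : ℝ → ℝ … smooth»)] -/
theorem contDiff_prof₂Ext (hk : 2 ≤ k) {m : ℕ∞} : ContDiff ℝ m (prof₂Ext k) := by
  have hT := T_pos hk
  have hcut : ContDiff ℝ m (fun t : ℝ => Real.smoothTransition (2 + 4 * T k * t)) :=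
    Real.smoothTransition.contDiff.comp (contDiff_const.add (contDiff_const.mul contDiff_id))
  refine contDiff_iff_contDiffAt.2 fun t => ?_
  by_cases ht : -3 / 4 < T k * t
  · have hden : 1 + T k * t ≠ 0 := by linarith
    have hprof : ContDiffAt ℝ m (prof₂ k) t := by
      unfold prof₂
      refine ContDiffAt.div ?_ ?_ hden
      · exact (contDiff_psi.comp (contDiff_id.div_const _)).contDiffAt
      · exact (contDiff_const.add (contDiff_const.mul contDiff_id)).contDiffAt
    exact hcut.contDiffAt.mul hprof
  · rw [not_lt] at ht
    have hev : prof₂Ext k =ᶠ[𝓝 t] fun _ => (0 : ℝ) := by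
      have hopen : IsOpen {u : ℝ | T k * u < -1 / 2} :=
        isOpen_lt (continuous_const.mul continuous_id) continuous_const
      filter_upwards [hopen.mem_nhds (show T k * t < -1 / 2 by linarith)] with u hu
      have hu' : T k * u < -1 / 2 := hu
      exact prof₂Ext_of_le (by linarith)
    exact (contDiffAt_const.congr_of_eventuallyEq hev)

/-- On `[0, ∞)` the derivative of `prof₂Ext k` is that of `h_k`. [cite: Maynard2016DenseClusters, Lemma 8.4] -/
theorem deriv_prof₂Ext_of_nonneg (hk : 2 ≤ k) {t : ℝ} (ht : 0 ≤ t) :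
    deriv (prof₂Ext k) t = deriv (prof₂ k) t := by
  have hT := T_pos hk
  refine Filter.EventuallyEq.deriv_eq ?_
  have hopen : IsOpen {u : ℝ | -1 < 4 * T k * u} :=
    isOpen_lt continuous_const (continuous_const.mul continuous_id)
  filter_upwards [hopen.mem_nhds (show -1 < 4 * T k * t by nlinarith)] with u hu
  exact prof₂Ext_of_gt hu

/-! ## §2 The one-profile majorant `F₂ ≤ k ∏ (g_k + h_k/k)` -/

/-- **`∑ⱼ bⱼ ∏_{i≠j} aᵢ ≤ ∏ᵢ (aᵢ + bᵢ)`** for `a, b ≥ 0` (the terms of the expanded product with exactly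
one `b`). [cite: Maynard2016DenseClusters, (7.6) (the shape of F₂)] -/
theorem sum_mul_prod_erase_le_prod_add {ι : Type*} [DecidableEq ι] (s : Finset ι) {a b : ι → ℝ}
    (ha : ∀ i ∈ s, 0 ≤ a i) (hb : ∀ i ∈ s, 0 ≤ b i) :
    ∑ j ∈ s, b j * ∏ i ∈ s.erase j, a i ≤ ∏ i ∈ s, (a i + b i) := by
  induction s using Finset.induction_on with
  | empty => simp
  | @insert x s hx ih =>
    have ha' : ∀ i ∈ s, 0 ≤ a i := fun i hi => ha i (Finset.mem_insert_of_mem hi)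
    have hb' : ∀ i ∈ s, 0 ≤ b i := fun i hi => hb i (Finset.mem_insert_of_mem hi)
    have hax : 0 ≤ a x := ha x (Finset.mem_insert_self x s)
    have hbx : 0 ≤ b x := hb x (Finset.mem_insert_self x s)
    have ih' := ih ha' hb'
    rw [Finset.sum_insert hx, Finset.prod_insert hx, Finset.erase_insert hx]
    have hrest : ∑ j ∈ s, b j * ∏ i ∈ (insert x s).erase j, a i =
        a x * ∑ j ∈ s, b j * ∏ i ∈ s.erase j, a i := by
      rw [Finset.mul_sum]
      refine Finset.sum_congr rfl fun j hj => ?_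
      have hjx : x ≠ j := fun h => hx (h ▸ hj)
      rw [Finset.erase_insert_of_ne hjx, Finset.prod_insert (fun h => hx (Finset.mem_of_mem_erase h))]
      ring
    rw [hrest]
    have hPa : ∏ i ∈ s, a i ≤ ∏ i ∈ s, (a i + b i) :=
      Finset.prod_le_prod ha' fun i hi => le_add_of_nonneg_right (hb' i hi)
    have hP0 : 0 ≤ ∏ i ∈ s, a i := Finset.prod_nonneg ha'
    calc b x * ∏ i ∈ s, a i + a x * ∑ j ∈ s, b j * ∏ i ∈ s.erase j, a i
        ≤ b x * ∏ i ∈ s, (a i + b i) + a x * ∏ i ∈ s, (a i + b i) :=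
          add_le_add (mul_le_mul_of_nonneg_left hPa hbx) (mul_le_mul_of_nonneg_left ih' hax)
      _ = (a x + b x) * ∏ i ∈ s, (a i + b i) := by ring

/-- **`F₂(t) ≤ k ∏ᵢ (g_k(tᵢ) + h_k(tᵢ)/k)`** on the orthant.
[cite: Maynard2016DenseClusters, (7.6), proof of Prop. 9.1 p. 20 (the E_diff sum with F₂)] -/
theorem F₂_le_mul_prod_mix (hk : 2 ≤ k) {t : Fin k → ℝ} (ht : t ∈ orthant k) :
    F₂ k t ≤ (k : ℝ) * ∏ i, (prof k (t i) + prof₂ k (t i) / k) := by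
  classical
  rw [mem_orthant] at ht
  have hk0 : (0 : ℝ) < k := by exact_mod_cast lt_of_lt_of_le (by norm_num) hk
  have h := sum_mul_prod_erase_le_prod_add (Finset.univ : Finset (Fin k))
    (a := fun i => prof k (t i)) (b := fun i => prof₂ k (t i) / k)
    (fun i _ => prof_nonneg hk (ht i)) (fun i _ => div_nonneg (prof₂_nonneg hk (ht i)) hk0.le)
  have hF : F₂ k t = (k : ℝ) * ∑ j, prof₂ k (t j) / k * ∏ i ∈ univ.erase j, prof k (t i) := by
    unfold F₂
    rw [Finset.mul_sum]
    refine Finset.sum_congr rfl fun j _ => ?_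
    field_simp
  rw [hF]
  exact mul_le_mul_of_nonneg_left h hk0.le

/-! ## §3 The mixed profile at scale `R²` and its `(G)`-hypotheses -/

/-- `mixG k s = profExt k (2s) + prof₂Ext k (2s)/k` (`= g_k(2s) + h_k(2s)/k` for `s ≥ 0`; supported in `s < 1`).
[cite: Maynard2016DenseClusters, Lemma 8.4 (a smooth G supported on [0,1]), (7.4)–(7.6)] -/
def mixG (k : ℕ) (s : ℝ) : ℝ := profExt k (2 * s) + prof₂Ext k (2 * s) / k

/-- On `[0, ∞)`: `mixG k s = g_k(2s) + h_k(2s)/k`. [cite: Maynard2016DenseClusters, (7.4)–(7.6)] -/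
theorem mixG_of_nonneg (hk : 2 ≤ k) {s : ℝ} (hs : 0 ≤ s) :
    mixG k s = prof k (2 * s) + prof₂ k (2 * s) / k := by
  unfold mixG
  rw [profExt_of_nonneg hk (by linarith), prof₂Ext_of_nonneg hk (by linarith)]

/-- `mixG k (u/2) = g_k(u) + h_k(u)/k` for `u ≥ 0`. [cite: Maynard2016DenseClusters, (7.4)–(7.6)] -/
theorem mixG_half (hk : 2 ≤ k) {u : ℝ} (hu : 0 ≤ u) : mixG k (u / 2) = prof k u + prof₂ k u / k := by
  rw [mixG_of_nonneg hk (by linarith)]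
  ring_nf

/-- `mixG k s = 0` for `s ≥ 1` (`g_k(2s) = 0` as `2s ≥ U_k`, `h_k(2s) = 0` as `2s ≥ 2`).
[cite: Maynard2016DenseClusters, Lemma 8.4 («supported on [0,1]»)] -/
theorem mixG_eq_zero (hk : 2 ≤ k) {s : ℝ} (hs : 1 ≤ s) : mixG k s = 0 := by
  have hk1 : 1 ≤ k := le_trans (by norm_num) hk
  rw [mixG_of_nonneg hk (by linarith), prof_eq_zero hk1 ((U_le_one hk1).trans (by linarith)),
    prof₂_eq_zero (by linarith)]
  simp

/-- `mixG k s = 0` for `s ≤ −1` (both cut-offs vanish). [cite: Maynard2016DenseClusters, Lemma 8.4] -/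
theorem mixG_eq_zero_of_le_neg_one (hk : 2 ≤ k) {s : ℝ} (hs : s ≤ -1) : mixG k s = 0 := by
  have hT := T_pos hk
  have hT1 : 1 ≤ T k := by
    unfold T
    have h2 : (2 : ℝ) ≤ k := by exact_mod_cast hk
    have hlog : Real.log 2 ≤ Real.log k := Real.log_le_log (by norm_num) h2
    have hl2 : (1 : ℝ) / 2 ≤ Real.log 2 := by
      have := Real.log_two_gt_d9; linarith
    nlinarith
  have h : 2 + 4 * T k * (2 * s) ≤ 0 := by nlinarith
  unfold mixG
  rw [profExt_of_le h, prof₂Ext_of_le h]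
  simp

/-- `0 ≤ mixG k s ≤ 2` for `s ≥ 0`. [cite: Maynard2016DenseClusters, (7.4)–(7.6) (0 ≤ g_k, h_k ≤ 1)] -/
theorem mixG_mem_Icc (hk : 2 ≤ k) {s : ℝ} (hs : 0 ≤ s) : mixG k s ∈ Set.Icc (0 : ℝ) 2 := by
  have hk1 : (1 : ℝ) ≤ k := by exact_mod_cast le_trans (by norm_num) hk
  have hk0 : (0 : ℝ) < k := by linarith
  rw [mixG_of_nonneg hk hs]
  have h2s : 0 ≤ 2 * s := by linarith
  have hp0 := prof_nonneg hk h2s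
  have hp1 := prof_le_one hk h2s
  have hq0 := prof₂_nonneg hk h2s
  have hq1 : prof₂ k (2 * s) ≤ 1 :=
    (prof₂_le_inv hk h2s).trans (by
      rw [div_le_one (by have := T_pos hk; positivity)]
      have := T_pos hk; nlinarith)
  refine ⟨add_nonneg hp0 (div_nonneg hq0 hk0.le), ?_⟩
  have : prof₂ k (2 * s) / k ≤ 1 := by rw [div_le_one hk0]; linarith
  linarith

/-- **`mixG k` is `C¹` (indeed smooth) on `ℝ`.** [cite: Maynard2016DenseClusters, Lemma 8.4 («G smooth»)] -/
theorem contDiff_mixG (hk : 2 ≤ k) {m : ℕ∞} : ContDiff ℝ m (mixG k) := by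
  unfold mixG
  have h2 : ContDiff ℝ m (fun s : ℝ => 2 * s) := contDiff_const.mul contDiff_id
  exact ((contDiff_profExt hk).comp h2).add (((contDiff_prof₂Ext hk).comp h2).div_const _)

/-- `|mixG'(s)| ≤ 2(15 + 30/U_k + 2T_k)` for `s ≥ 0` (chain rule, `|g_k'| ≤ 30/U_k + T_k`, `|h_k'| ≤ 15 + T_k`).
[cite: Maynard2016DenseClusters, proof of Lemma 8.5 («Ω_G = O(kT_k)»)] -/
theorem abs_deriv_mixG_le (hk : 2 ≤ k) {s : ℝ} (hs : 0 ≤ s) :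
    |deriv (mixG k) s| ≤ 2 * (15 + 30 / U k + 2 * T k) := by
  have hk1 : (1 : ℝ) ≤ k := by exact_mod_cast le_trans (by norm_num) hk
  have hk0 : (0 : ℝ) < k := by linarith
  have hT := T_pos hk
  have hU := U_pos (le_trans (by norm_num) hk)
  have h2s : 0 ≤ 2 * s := by linarith
  -- derivative via the chain rule
  have hd1 : HasDerivAt (fun s : ℝ => profExt k (2 * s)) (deriv (profExt k) (2 * s) * 2) s := by
    have h := ((contDiff_profExt hk (m := 1)).differentiable (by simp)).differentiableAt.hasDerivAt
      (x := 2 * s)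
    exact h.comp s (by simpa using (hasDerivAt_id s).const_mul (2 : ℝ))
  have hd2 : HasDerivAt (fun s : ℝ => prof₂Ext k (2 * s) / k) (deriv (prof₂Ext k) (2 * s) * 2 / k) s := by
    have h := ((contDiff_prof₂Ext hk (m := 1)).differentiable (by simp)).differentiableAt.hasDerivAt
      (x := 2 * s)
    exact (h.comp s (by simpa using (hasDerivAt_id s).const_mul (2 : ℝ))).div_const _
  have hd : HasDerivAt (mixG k) (deriv (profExt k) (2 * s) * 2 + deriv (prof₂Ext k) (2 * s) * 2 / k) s := by
    have := hd1.add hd2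
    exact this
  rw [hd.deriv, deriv_profExt_of_nonneg hk h2s, deriv_prof₂Ext_of_nonneg hk h2s]
  have ha := abs_deriv_prof_le hk h2s
  have hb := abs_deriv_prof₂_le hk h2s
  have hb' : |deriv (prof₂ k) (2 * s) * 2 / k| ≤ (15 + T k) * 2 := by
    rw [abs_div, abs_mul, abs_two, abs_of_pos hk0, div_le_iff₀ hk0]
    nlinarith [abs_nonneg (deriv (prof₂ k) (2 * s))]
  calc |deriv (prof k) (2 * s) * 2 + deriv (prof₂ k) (2 * s) * 2 / k|
      ≤ |deriv (prof k) (2 * s) * 2| + |deriv (prof₂ k) (2 * s) * 2 / k| := abs_add_le _ _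
    _ ≤ (30 / U k + T k) * 2 + (15 + T k) * 2 := by
        refine add_le_add ?_ hb'
        rw [abs_mul, abs_two]; nlinarith [abs_nonneg (deriv (prof k) (2 * s))]
    _ = 2 * (15 + 30 / U k + 2 * T k) := by ring

/-- The `Ω_G`-constant for `G = mixG²`: `Gs = 4 + 8(15 + 30/U_k + 2T_k)`.
[cite: Maynard2016DenseClusters, proof of Lemma 8.5 («Ω_G = O(kT_k)»)] -/
def GsMix (k : ℕ) : ℝ := 4 + 8 * (15 + 30 / U k + 2 * T k)

/-- `GsMix k ≤ 62 · 2(1 + 30/U_k + T_k)` (to reuse the bound `2(1 + 30/U_k + T_k) ≤ 3(k log k)² γ_k`).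
[cite: Maynard2016DenseClusters, proof of Lemma 8.5 («Ω_G = O(kT_k)»)] -/
theorem GsMix_le (hk : 2 ≤ k) : GsMix k ≤ 62 * (2 * (1 + 30 / U k + T k)) := by
  have hT := T_pos hk
  have hU := U_pos (le_trans (by norm_num) hk)
  have h30 : 0 ≤ 30 / U k := by positivity
  unfold GsMix
  nlinarith

/-- **The `(G)`-hypotheses of `lemma84_all'_dec` for `G = mixG²`**: `C¹`, `≥ 0`, `= 0` on `[1,∞)`, integrable,
`sup_{[0,1]} (|G| + |G'|) ≤ GsMix k`, `∫₀^∞ G > 0`.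
[cite: Maynard2016DenseClusters, Lemma 8.4 (hypotheses on G), proof of Prop. 9.1 p. 20] -/
theorem lemma84_hypG_mixSq (hk : 2 ≤ k) :
    ContDiff ℝ 1 (fun t => mixG k t ^ 2) ∧ (∀ t, 0 ≤ mixG k t ^ 2) ∧
      (∀ t, 1 ≤ t → mixG k t ^ 2 = 0) ∧
      Integrable ((Set.Ici (0 : ℝ)).indicator fun t => mixG k t ^ 2) ∧
      (∀ t ∈ Set.Icc (0 : ℝ) 1, |mixG k t ^ 2| + |deriv (fun t => mixG k t ^ 2) t| ≤ GsMix k) := by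
  have hcd : ContDiff ℝ 1 (mixG k) := contDiff_mixG hk
  have hcd2 : ContDiff ℝ 1 (fun t => mixG k t ^ 2) := hcd.pow 2
  refine ⟨hcd2, fun t => sq_nonneg _, fun t ht => by rw [mixG_eq_zero hk ht]; ring, ?_, fun t ht => ?_⟩
  · -- compact support `⊆ [-1, 1]`
    have hcs : HasCompactSupport (fun t => mixG k t ^ 2) := by
      refine HasCompactSupport.intro (isCompact_Icc : IsCompact (Set.Icc (-1 : ℝ) 1)) fun t ht => ?_
      rw [Set.mem_Icc, not_and_or, not_le, not_le] at ht
      rcases ht with ht | ht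
      · rw [mixG_eq_zero_of_le_neg_one hk ht.le]; ring
      · rw [mixG_eq_zero hk ht.le]; ring
    exact (hcd2.continuous.integrable_of_hasCompactSupport hcs).indicator measurableSet_Ici
  · have hd : HasDerivAt (fun t => mixG k t ^ 2) (((2 : ℕ) : ℝ) * mixG k t ^ (2 - 1) * deriv (mixG k) t) t :=
      ((hcd.differentiable (by simp)).differentiableAt.hasDerivAt).pow 2
    rw [hd.deriv]
    have h0 : 0 ≤ mixG k t := (mixG_mem_Icc hk ht.1).1
    have h1 : mixG k t ≤ 2 := (mixG_mem_Icc hk ht.1).2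
    have hb := abs_deriv_mixG_le hk ht.1
    simp only [Nat.cast_ofNat, Nat.add_one_sub_one, pow_one]
    rw [abs_of_nonneg (sq_nonneg _), abs_mul, abs_mul, abs_of_nonneg h0, abs_two]
    unfold GsMix
    have hT := T_pos hk
    have hU := U_pos (le_trans (by norm_num) hk)
    have hK : 0 ≤ 15 + 30 / U k + 2 * T k := by positivity
    nlinarith [abs_nonneg (deriv (mixG k) t), mul_le_mul_of_nonneg_right h1 h0,
      mul_le_mul h1 hb (abs_nonneg _) (by norm_num : (0:ℝ) ≤ 2)]

/-! ## §4 `γ_k/2 ≤ ∫₀^∞ mixG² ≤ (γ_k + 3γ_{h,k}/k)/2` -/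

/-- `∫₀^∞ g_k² = γ_k` (set-integral form). [cite: Maynard2016DenseClusters, proof of Lemma 8.6 (γ)] -/
theorem setIntegral_Ioi_prof_sq (hk : 2 ≤ k) : ∫ u in Set.Ioi (0 : ℝ), prof k u ^ 2 = gam k := by
  obtain ⟨-, -, -, -, -, hI, -⟩ := lemma84_hypG_profExt_sq hk
  rw [← integral_Ici_eq_integral_Ioi, ← hI]
  exact setIntegral_congr_fun measurableSet_Ici fun u hu => by rw [profExt_of_nonneg hk hu]

/-- `∫₀^∞ h_k² = γ_{h,k}` (set-integral form). [cite: Maynard2016DenseClusters, proof of Lemma 8.6] -/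
theorem setIntegral_Ioi_prof₂_sq (k : ℕ) : ∫ u in Set.Ioi (0 : ℝ), prof₂ k u ^ 2 = gam₂ k := by
  rw [← integral_Ici_eq_integral_Ioi, gam₂, ← integral_indicator measurableSet_Ici]
  refine integral_congr_ae (Filter.Eventually.of_forall fun x => ?_)
  show (Set.Ici (0 : ℝ)).indicator (fun u => prof₂ k u ^ 2) x = prof₂Cut k x ^ 2
  by_cases hx : x ∈ Set.Ici (0 : ℝ)
  · rw [Set.indicator_of_mem hx, prof₂Cut_of_nonneg (Set.mem_Ici.1 hx)]
  · rw [Set.indicator_of_notMem hx, prof₂Cut_of_neg (not_le.1 (fun h => hx (Set.mem_Ici.2 h)))]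
    ring

/-- `(g_k + h_k/k)²` is integrable on `(0, ∞)` (dominated by `4h_k²`).
[cite: Maynard2016DenseClusters, Lemma 8.6 (integrability of the profiles)] -/
theorem integrableOn_mix_sq (hk : 2 ≤ k) :
    IntegrableOn (fun u => (prof k u + prof₂ k u / k) ^ 2) (Set.Ioi (0 : ℝ)) := by
  have hk1 : (1 : ℝ) ≤ k := by exact_mod_cast le_trans (by norm_num) hk
  have hk0 : (0 : ℝ) < k := by linarith
  have hdom : IntegrableOn (fun u => 4 * prof₂Cut k u ^ 2) (Set.Ioi (0 : ℝ)) :=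
    ((integrable_prof₂Cut_sq hk).const_mul 4).integrableOn
  refine hdom.mono' ?_ ?_
  · exact (((measurable_prof k).add ((measurable_prof₂ k).div_const _)).pow_const 2).aestronglyMeasurable
  · refine (ae_restrict_iff' measurableSet_Ioi).2 (Filter.Eventually.of_forall fun u hu => ?_)
    have hu0 : 0 ≤ u := le_of_lt hu
    rw [Real.norm_eq_abs, abs_of_nonneg (sq_nonneg _), prof₂Cut_of_nonneg hu0]
    have ha := prof_nonneg hk hu0
    have hab := prof_le_prof₂ hk hu0
    have hb1 : prof₂ k u / k ≤ prof₂ k u := div_le_self (prof₂_nonneg hk hu0) hk1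
    have hb0 : 0 ≤ prof₂ k u / k := div_nonneg (prof₂_nonneg hk hu0) hk0.le
    nlinarith

/-- **Substitution**: `∫₀^∞ mixG² = ½ ∫₀^∞ (g_k + h_k/k)²`. [cite: Maynard2016DenseClusters, Lemma 8.4 (∫₀^∞ G)] -/
theorem setIntegral_Ici_mixG_sq (hk : 2 ≤ k) :
    ∫ u in Set.Ici (0 : ℝ), mixG k u ^ 2 = (1 / 2) * ∫ u in Set.Ioi (0 : ℝ), (prof k u + prof₂ k u / k) ^ 2 := by
  rw [integral_Ici_eq_integral_Ioi]
  have h1 : ∫ u in Set.Ioi (0 : ℝ), mixG k u ^ 2 =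
      ∫ u in Set.Ioi (0 : ℝ), (fun s => (prof k s + prof₂ k s / k) ^ 2) (2 * u) :=
    setIntegral_congr_fun measurableSet_Ioi fun u hu => by
      simp only; rw [mixG_of_nonneg hk (le_of_lt hu)]
  rw [h1, integral_comp_mul_left_Ioi (fun s => (prof k s + prof₂ k s / k) ^ 2) 0 two_pos, mul_zero,
    smul_eq_mul]
  norm_num

/-- **`γ_k/2 ≤ ∫₀^∞ mixG²`** (drop `h_k ≥ 0`). [cite: Maynard2016DenseClusters, proof of Lemma 8.6 (γ)] -/
theorem half_gam_le_setIntegral_mixG_sq (hk : 2 ≤ k) :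
    gam k / 2 ≤ ∫ u in Set.Ici (0 : ℝ), mixG k u ^ 2 := by
  have hk0 : (0 : ℝ) < k := by exact_mod_cast lt_of_lt_of_le (by norm_num) hk
  rw [setIntegral_Ici_mixG_sq hk, ← setIntegral_Ioi_prof_sq hk]
  have hmono : ∫ u in Set.Ioi (0 : ℝ), prof k u ^ 2 ≤ ∫ u in Set.Ioi (0 : ℝ), (prof k u + prof₂ k u / k) ^ 2 := by
    refine setIntegral_mono_on ?_ (integrableOn_mix_sq hk) measurableSet_Ioi fun u hu => ?_
    · have h := (integrable_profCut_sq hk).integrableOn (s := Set.Ioi (0 : ℝ))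
      exact h.congr_fun (fun u hu => by simp only; rw [profCut_of_nonneg (le_of_lt hu)]) measurableSet_Ioi
    · have ha := prof_nonneg hk (le_of_lt hu)
      have hb : 0 ≤ prof₂ k u / k := div_nonneg (prof₂_nonneg hk (le_of_lt hu)) hk0.le
      nlinarith
  linarith

/-- **`∫₀^∞ mixG² ≤ (γ_k + 3γ_{h,k}/k)/2`** (`g_k h_k ≤ h_k²`, `1/k² ≤ 1/k`).
[cite: Maynard2016DenseClusters, proof of Lemma 8.6 (γ, and ∫ h_k² ≤ 1/T_k)] -/
theorem setIntegral_mixG_sq_le (hk : 2 ≤ k) :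
    ∫ u in Set.Ici (0 : ℝ), mixG k u ^ 2 ≤ (gam k + 3 / k * gam₂ k) / 2 := by
  have hk1 : (1 : ℝ) ≤ k := by exact_mod_cast le_trans (by norm_num) hk
  have hk0 : (0 : ℝ) < k := by linarith
  rw [setIntegral_Ici_mixG_sq hk]
  have hI1 : IntegrableOn (fun u => prof k u ^ 2) (Set.Ioi (0 : ℝ)) :=
    ((integrable_profCut_sq hk).integrableOn (s := Set.Ioi (0 : ℝ))).congr_fun
      (fun u hu => by simp only; rw [profCut_of_nonneg (le_of_lt hu)]) measurableSet_Ioi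
  have hI2 : IntegrableOn (fun u => prof₂ k u ^ 2) (Set.Ioi (0 : ℝ)) :=
    ((integrable_prof₂Cut_sq hk).integrableOn (s := Set.Ioi (0 : ℝ))).congr_fun
      (fun u hu => by simp only; rw [prof₂Cut_of_nonneg (le_of_lt hu)]) measurableSet_Ioi
  have hmono : ∫ u in Set.Ioi (0 : ℝ), (prof k u + prof₂ k u / k) ^ 2 ≤
      ∫ u in Set.Ioi (0 : ℝ), (prof k u ^ 2 + 3 / k * prof₂ k u ^ 2) := by
    refine setIntegral_mono_on (integrableOn_mix_sq hk) (hI1.add (hI2.const_mul _)) measurableSet_Ioi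
      fun u hu => ?_
    have ha := prof_nonneg hk (le_of_lt hu)
    have hab := prof_le_prof₂ hk (le_of_lt hu)
    have hb := prof₂_nonneg hk (le_of_lt hu)
    -- `(a + b/k)² = a² + 2ab/k + b²/k² ≤ a² + 2b²/k + b²/k`
    have h1 : prof k u * prof₂ k u ≤ prof₂ k u ^ 2 := by nlinarith
    have h2 : prof₂ k u ^ 2 / k ^ 2 ≤ prof₂ k u ^ 2 / k := by
      rw [div_le_div_iff₀ (by positivity) hk0]
      have hkk : (k : ℝ) ≤ (k : ℝ) ^ 2 := by nlinarith
      exact mul_le_mul_of_nonneg_left hkk (sq_nonneg _)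
    have e : (prof k u + prof₂ k u / k) ^ 2 =
        prof k u ^ 2 + 2 / k * (prof k u * prof₂ k u) + prof₂ k u ^ 2 / k ^ 2 := by
      field_simp; ring
    rw [e]
    have h3 : 2 / k * (prof k u * prof₂ k u) ≤ 2 / k * prof₂ k u ^ 2 :=
      mul_le_mul_of_nonneg_left h1 (by positivity)
    calc prof k u ^ 2 + 2 / k * (prof k u * prof₂ k u) + prof₂ k u ^ 2 / k ^ 2
        ≤ prof k u ^ 2 + 2 / k * prof₂ k u ^ 2 + prof₂ k u ^ 2 / k := by linarith
      _ = prof k u ^ 2 + 3 / k * prof₂ k u ^ 2 := by ring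
  rw [integral_add hI1 (hI2.const_mul _), integral_const_mul, setIntegral_Ioi_prof_sq hk,
    setIntegral_Ioi_prof₂_sq] at hmono
  linarith

/-- **`(2 ∫₀^∞ mixG²)^k ≤ e^4 γ_k^k`** for `k ≥ 2¹⁸` (`γ_{h,k} ≤ 1/T_k ≤ (5000/4999) γ_k`, `(1 + a/k)^k ≤ e^a`).
[cite: Maynard2016DenseClusters, proof of Lemma 8.6 («γ», «∫ h_k² ≤ T_k^{-1}»)] -/
theorem two_mul_setIntegral_mixG_sq_pow_le (hk : 262144 ≤ k) :
    (2 * ∫ u in Set.Ici (0 : ℝ), mixG k u ^ 2) ^ k ≤ Real.exp 4 * gam k ^ k := by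
  have hk2 : 2 ≤ k := le_trans (by norm_num) hk
  have hk0 : (0 : ℝ) < k := by exact_mod_cast lt_of_lt_of_le (by norm_num) hk
  have hγ := gam_pos hk2
  have hT := T_pos hk2
  have hγ₂ : gam₂ k ≤ (10003 / 10000) * gam k := by
    have h1 := gam₂_le_inv hk2
    have hγT : 4999 / 5000 ≤ gam k * T k := gam_mul_T_ge hk
    have : (T k)⁻¹ ≤ (10003 / 10000) * gam k := by
      rw [inv_le_iff_one_le_mul₀ hT]
      have e : 10003 / 10000 * gam k * T k = 10003 / 10000 * (gam k * T k) := by ring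
      rw [e]; linarith
    linarith
  have hup := setIntegral_mixG_sq_le hk2
  have hI0 : 0 ≤ ∫ u in Set.Ici (0 : ℝ), mixG k u ^ 2 := le_trans (by positivity) (half_gam_le_setIntegral_mixG_sq hk2)
  have h1 : 2 * ∫ u in Set.Ici (0 : ℝ), mixG k u ^ 2 ≤ gam k * (1 + 4 / k) := by
    have h3 : 3 / (k : ℝ) * gam₂ k ≤ 3 / k * ((10003 / 10000) * gam k) :=
      mul_le_mul_of_nonneg_left hγ₂ (by positivity)
    have e1 : 3 / (k : ℝ) * ((10003 / 10000) * gam k) = 30009 / 10000 * (gam k / k) := by ring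
    have e : gam k * (1 + 4 / k) = gam k + 4 * (gam k / k) := by ring
    have e2 : 3 / (k : ℝ) * gam₂ k = 3 * (gam₂ k / k) := by ring
    have hγk : 0 ≤ gam k / k := by positivity
    rw [e]
    rw [e1] at h3
    have hup' : 2 * ∫ u in Set.Ici (0 : ℝ), mixG k u ^ 2 ≤ gam k + 3 / k * gam₂ k := by linarith
    linarith
  have h2 : (1 + 4 / (k : ℝ)) ^ k ≤ Real.exp 4 := by
    have h := Real.add_one_le_exp (4 / (k : ℝ))
    have h' : (1 + 4 / (k : ℝ)) ^ k ≤ Real.exp (4 / k) ^ k :=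
      pow_le_pow_left₀ (by positivity) (by linarith) k
    rw [← Real.exp_nat_mul, mul_div_cancel₀ _ hk0.ne'] at h'
    exact h'
  calc (2 * ∫ u in Set.Ici (0 : ℝ), mixG k u ^ 2) ^ k ≤ (gam k * (1 + 4 / k)) ^ k :=
        pow_le_pow_left₀ (by positivity) h1 k
    _ = gam k ^ k * (1 + 4 / (k : ℝ)) ^ k := mul_pow _ _ _
    _ ≤ gam k ^ k * Real.exp 4 := mul_le_mul_of_nonneg_left h2 (by positivity)
    _ = Real.exp 4 * gam k ^ k := mul_comm _ _

end Literature.NumberTheory.Sieve.MaynardDense
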